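import Literature.AlgebraicGeometry.HodgeTheory.ComplexTorusIntegralHodgeClassesPontryaginCorrespondences
import Literature.AlgebraicGeometry.HodgeTheory.ComplexTorusIntegralHodgeClassesRelativePontryaginAssociativity
import Literature.AlgebraicGeometry.HodgeTheory.ComplexTorusIntegralHodgeClassesCorrespondenceTranspose
import Literature.AlgebraicGeometry.HodgeTheory.ComplexTorusIntegralHodgeClassesKunnethGrading
import HarnessLib

/-!
# Pontryagin correspondences II: `ᵗΠ_c = Π_c`, `(Π_c)^* = (−) ⋆ c`, `Π_c ∘ Π_{c′} = Π_{c′ ⋆ c}`, `Γ_f ∘ Π_c = Π_{f_*c} ∘ Γ_f`, `Π_{[pt]} = [Δ]`, `[H, Π_c] = (2d − 2g) Π_c`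

Sequel to g33-#7 `ComplexTorusIntegralHodgeClassesPontryaginCorrespondences`, on the integral carriers `Hdg•(−, ℤ)` of complex tori. There, for `c ∈ Hdgᵈ(X, ℤ)`, the
PONTRYAGIN CORRESPONDENCE `Π_c := (s_X)_*(p₂^*c) = [Δ_X] ⋆_X (X × c) ∈ Hdgᵈ(X × X, ℤ)` (`s_X = (pr₁, pr₁ + pr₂)` the shear) was shown to induce the Pontryagin
product, `(Π_c)_*(x) = x ⋆ c` ("on Chow groups, `Λ_β` is the `∗`-product with the class `λ(β)`" [cite: Moonen2011ChowMotiveAbelianSchemes, §5 (arXiv p0014 L78)]), and to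
compose as `Π_c ∘ α = α ⋆_W (W × c)`. This file completes the calculus of these correspondences inside Fulton's ring of correspondences `(A(X × X), ∘, [Δ], ′)`
[cite: Fulton1998, §16.1 Cor. 16.1.1, Prop. 16.1.1 (c), Prop. 16.1.2 (p0293–p0295)] and Lange's Pontryagin ring `(Ch(X), +, ⋆)` [cite: Lange2023AbelianVarietiesComplex, §6.2.3
(p0308 L3–L12)]:

* §0 plumbing in the preadditive category `ComplexTorusCat`: the involution `n_X = (μ, −pr₂) : (x, y) ↦ (x + y, −y)` of `X × X` with `n ≫ s = s ≫ τ` (`τ` the exchange of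
  the factors), `n ≫ n = 1`; `s_X ≫ (1 × f) = (1 × f) ≫ s_f` for the shear `s_f = (pr₁, f pr₁ + pr₂)` of `X × Y`; `ι₁ ≫ s = Δ`; `s` is an isomorphism;
* §1 **`ᵗΠ_c = Π_c`: PONTRYAGIN CORRESPONDENCES ARE SYMMETRIC** (`τ_*s_* = s_*n_*`, `n_*p₂^* = p₂^*(−1)^*` and `(−1)^* = (−1)^{2d} = 1` on `Hdgᵈ(X, ℤ) ⊂ H^{2d}`
  [cite: Lange2023AbelianVarietiesComplex, §6.3.1 (p0313 L5–L15: "`n_X^*` acts … by multiplication by `n^{2p}` on `H^{2p}`")]) — as `ᵗ(Δ_*(u)) = Δ_*(u)` for the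
  multiplication correspondences (g33-#3);
* §2 **`(Π_c)^*(y) = y ⋆ c`**: by symmetry the contravariant action `α^*(b) = p_{1*}(α · p₂^*b)` [cite: Fulton1998, §16.1 Def. 16.1.2 and Prop. 16.1.2 (b) (p0295 L9–L26)] of `Π_c` is
  again the Pontryagin product with `c` [cite: Lange2023AbelianVarietiesComplex, §6.2.3 (p0308 L3–L7)];
* §3 **`Π_c ∘ Π_{c′} = Π_{c′ ⋆ c}`** (composite `p₁₃_*(p₁₂^*Π_{c′} · p₂₃^*Π_c)` on `X × (X × X)`): `c ↦ Π_c` turns the Pontryagin product of `X` into the composition of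
  correspondences — Lange's "`(Ch(X)_ℚ, +, ⋆)` is a commutative ring" realised inside the ring of correspondences: `Π_c ∘ Π_{c′} = Π_{c′} ⋆_X (X × c) = ([Δ] ⋆_X (X ×
  c′)) ⋆_X (X × c) = [Δ] ⋆_X (X × (c′ ⋆ c))` by g33-#7 §§1, 3, 4 and the associativity of `⋆_X` (g31-#10) [cite: Lange2023AbelianVarietiesComplex, §6.2.3 (p0308 L3–L12) and
  §6.3.4 (p0319 L36–L41)] [cite: Fulton1998, §16.1 Def. 16.1.1 (p0293 L3–L8)]; hence `Π_c ∘ Π_{c′} = Π_{c′} ∘ Π_c`;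
* §4 **`Γ_f ∘ Π_c = (s_f)_*(p₂^*(f_*c)) = Π_{f_*c} ∘ Γ_f` for every homomorphism `f : X → Y`**: the correspondence form of "`f_*(x ⋆ c) = f_*x ⋆ f_*c`" (g31-#4
  `integralHodgeClassesPushforward_pontryagin`) — `Γ_f ∘ α = (1 × f)_*α` [cite: Fulton1998, §16.1 Prop. 16.1.1 (c)(i) (p0293 L24; p0294 L21–L26)], the base change
  `(1 × f)_*p₂^* = p₂^*f_*` [cite: Fulton1998, §1.7 Prop. 1.7 (p0030)], and the shear formula `[Γ_f] ⋆_X β = (s_f)_*β` (g31-#5)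
  [cite: Lange2023AbelianVarietiesComplex, §6.3.4 Lemma 6.3.13 (proof, p0320 L13–L17) and §6.2.3 (p0308 L3–L7)];
* §5 special values: **`Π_{[pt]} = [Δ_X]`** (`x ⋆ [pt] = x`: the point class is the unit of `⋆` [cite: Lange2023AbelianVarietiesComplex, §6.2.3 (p0308 L8–L12)]), **`Π_{1_X} =
  1_{X×X}`**, and `c ↦ Π_c` is additive;
* §6 **`H ∘ Π_c − Π_c ∘ H = (2d − 2g) • Π_c`**: the Künneth weight of `Π_c ∈ Hdgᵈ(X × X, ℤ)` (g33-#5's weight identity `H_Z ∘ α − α ∘ H_X = (2a − g_X − g_Z) • α`); for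
  `d = g − 1` this is the relation **`[H, Λ] = −2Λ`** of Künnemann's Lefschetz 𝔰𝔩₂-triple, `Λ` being "the `∗`-product with the class `λ(β)`" of degree `g − 1`
  [cite: Moonen2011ChowMotiveAbelianSchemes, §5 (arXiv p0014 L47–L78, p0015 L2–L12)] [cite: Huybrechts2005, §1.2 Prop. 1.2.26 (p0047)].

All statements are theorems; no definition, no named fact (D-0026). Frames (`eX`, `eXX`, `eT`, …) and the degree bookkeeping hypotheses are explicit and arbitrary, as in
g27–g33 of this series.

## References

* [Lange2023AbelianVarietiesComplex] H. Lange, Abelian Varieties over the Complex Numbers, Springer 2023 — §6.2.3 (Pontryagin product), §6.3.1, §6.3.4 (relative Pontryagin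
  product, Lemma 6.3.13).
* [Fulton1998] W. Fulton, Intersection Theory, 2nd ed., Springer 1998 — §16.1 Def. 16.1.1, 16.1.2, Prop. 16.1.1, 16.1.2, Cor. 16.1.1; §1.7 Prop. 1.7.
* [Moonen2011ChowMotiveAbelianSchemes] B. Moonen, On the Chow motive of an abelian scheme with non-trivial endomorphisms, J. reine angew. Math. 711 (2016), arXiv:1110.4264 — §5.
* [Huybrechts2005] D. Huybrechts, Complex Geometry, Springer 2005 — §1.2 Def. 1.2.25, Prop. 1.2.26.
-/

noncomputable section

open CategoryTheory Function

namespace Literature.AlgebraicGeometry.HodgeTheory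

open Literature.AlgebraicGeometry.Motives Literature.AlgebraicGeometry.Motives.HodgeStructure
open Literature.Geometry.Kaehler Literature.Geometry.Kaehler.ComplexTorus

namespace ComplexTorusCat

/-! ## §0 Plumbing: the involution `n = (μ, −pr₂)`, the shears `s_X`, `s_f`, and `ι₁ ≫ s = Δ` -/

section Plumbing

variable (X : ComplexTorusCat) {Y : ComplexTorusCat} (f : X ⟶ Y)

/-- `n ≫ pr₂ = pr₂ ≫ (−1)_X` for `n = (μ, −pr₂) : (x, y) ↦ (x + y, −y)`. [cite: Lange2023AbelianVarietiesComplex, §1.1.2 (p0019 L18–L26)] -/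
theorem liftHom_addHom_sndNeg_comp_sndHom : liftHom (addHom X) (sndHom X X ≫ intMul X (-1)) ≫ sndHom X X = sndHom X X ≫ intMul X (-1) :=
  liftHom_sndHom _ _

/-- **`n ≫ s = s ≫ τ`**: `(x, y) ↦ (x + y, −y) ↦ (x + y, x)` equals `(x, y) ↦ (x, x + y) ↦ (x + y, x)` for the shear `s = (pr₁, pr₁ + pr₂)` and the exchange `τ` of the
two factors. [cite: Lange2023AbelianVarietiesComplex, §6.3.4 (p0319 L28–L36) and §1.1.2 (p0019 L18–L26)] -/
theorem liftHom_addHom_sndNeg_comp_liftHom_fst_add :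
    liftHom (addHom X) (sndHom X X ≫ intMul X (-1)) ≫ liftHom (fstHom X X) (fstHom X X + sndHom X X) =
      liftHom (fstHom X X) (fstHom X X + sndHom X X) ≫ swapHom X X := by
  refine prod_hom_ext ?_ ?_
  · simp only [Category.assoc, liftHom_fstHom, swapHom_fstHom, liftHom_sndHom, addHom_def]
  · simp only [Category.assoc, liftHom_sndHom, swapHom_sndHom, liftHom_fstHom, Preadditive.comp_add, addHom_def, comp_intMul, neg_smul, one_smul,
      add_neg_cancel_right]

/-- **`n ≫ n = 1`**: `(x, y) ↦ (x + y, −y)` is an involution of `X × X`. [cite: Lange2023AbelianVarietiesComplex, §1.1.2 (p0019 L18–L26)] -/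
theorem liftHom_addHom_sndNeg_comp_self :
    liftHom (addHom X) (sndHom X X ≫ intMul X (-1)) ≫ liftHom (addHom X) (sndHom X X ≫ intMul X (-1)) = 𝟙 (prodObj X X) := by
  refine prod_hom_ext ?_ ?_
  · simp only [Category.assoc, liftHom_fstHom, Category.id_comp, addHom_def, Preadditive.comp_add, liftHom_sndHom, comp_intMul, neg_smul, one_smul,
      add_neg_cancel_right]
  · simp only [Category.assoc, liftHom_sndHom, Category.id_comp, comp_intMul, neg_smul, one_smul, Preadditive.comp_neg, neg_neg]

/-- **`s_X ≫ (1_X × f) = (1_X × f) ≫ s_f`** for the shears `s_X = (pr₁, pr₁ + pr₂)` of `X × X` and `s_f = (pr₁, f pr₁ + pr₂)` of `X × Y` (`f` is additive).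
[cite: Lange2023AbelianVarietiesComplex, §6.3.4 (p0319 L28–L36) and §1.1.2 (p0019 L18–L26)] -/
theorem liftHom_fst_add_comp_prodMap_id :
    liftHom (fstHom X X) (fstHom X X + sndHom X X) ≫ prodMap (𝟙 X) f = prodMap (𝟙 X) f ≫ liftHom (fstHom X Y) (fstHom X Y ≫ f + sndHom X Y) := by
  refine prod_hom_ext ?_ ?_
  · simp only [Category.assoc, prodMap_fstHom, Category.comp_id, liftHom_fstHom]
  · simp only [Category.assoc, prodMap_sndHom, liftHom_sndHom_assoc, Preadditive.add_comp, liftHom_sndHom, Preadditive.comp_add, prodMap_fstHom_assoc,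
      Category.id_comp, prodMap_sndHom]

/-- **`ι₁ ≫ s = Δ`**: the shear carries the horizontal axis `X × (0)` to the diagonal (`(x, 0) ↦ (x, x)`). [cite: Lange2023AbelianVarietiesComplex, §6.3.4 Lemma 6.3.13 (proof, p0320 L13–L17)] -/
theorem inlHom_comp_liftHom_fst_add : inlHom X X ≫ liftHom (fstHom X X) (fstHom X X + sndHom X X) = diagHom X := by
  refine prod_hom_ext ?_ ?_
  · simp only [Category.assoc, liftHom_fstHom, inlHom_fstHom, diagHom_fstHom]
  · simp only [Category.assoc, liftHom_sndHom, Preadditive.comp_add, inlHom_fstHom, inlHom_sndHom, add_zero, diagHom_sndHom]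

/-- `s ≫ (pr₁, pr₂ − pr₁) = 1`: the shear is an isomorphism, with inverse `(x, y) ↦ (x, y − x)`. [cite: Lange2023AbelianVarietiesComplex, §6.3.4 (p0319 L28–L36)] -/
theorem liftHom_fst_add_comp_liftHom_fst_sub :
    liftHom (fstHom X X) (fstHom X X + sndHom X X) ≫ liftHom (fstHom X X) (sndHom X X - fstHom X X) = 𝟙 (prodObj X X) := by
  refine prod_hom_ext ?_ ?_
  · simp only [Category.assoc, liftHom_fstHom, Category.id_comp]
  · simp only [Category.assoc, liftHom_sndHom, Preadditive.comp_sub, liftHom_fstHom, add_sub_cancel_left, Category.id_comp]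

/-- `(pr₁, pr₂ − pr₁) ≫ s = 1`. [cite: Lange2023AbelianVarietiesComplex, §6.3.4 (p0319 L28–L36)] -/
theorem liftHom_fst_sub_comp_liftHom_fst_add :
    liftHom (fstHom X X) (sndHom X X - fstHom X X) ≫ liftHom (fstHom X X) (fstHom X X + sndHom X X) = 𝟙 (prodObj X X) := by
  refine prod_hom_ext ?_ ?_
  · simp only [Category.assoc, liftHom_fstHom, Category.id_comp]
  · simp only [Category.assoc, liftHom_sndHom, Preadditive.comp_add, liftHom_fstHom, add_sub_cancel, Category.id_comp]

end Plumbing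

/-! ## §1 `ᵗΠ_c = Π_c` -/

section Transpose

variable (X : ComplexTorusCat) {gX gXX : ℕ} (eX : Fin (2 * gX) ≃ X.toIsog.ι) (eXX : Fin (2 * gXX) ≃ (prodObj X X).toIsog.ι) (hgX : gX + gX = 2 * gX)
  (hgXX : gXX + gXX = 2 * gXX) {d L : ℕ} (hq : L + 2 * d = 2 * gXX)

/-- **`n^*(p₂^*c) = p₂^*c`** for `n = (μ, −pr₂)` and every `c ∈ Hdgᵈ(X, ℤ)`: `n ≫ pr₂ = pr₂ ≫ (−1)_X` and `(−1)_X^* = (−1)^{2d} = 1` on `Hdgᵈ(X, ℤ) ⊂ H^{2d}(X, ℤ)` (g24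
`integralHodgeClassesPullbackHom_intMul`). [cite: Lange2023AbelianVarietiesComplex, §6.3.1 (p0313 L5–L15)] -/
theorem integralHodgeClassesPullbackHom_liftHom_addHom_sndNeg_pullbackHom_sndHom (c : integralHodgeClasses X.toIsog.Φ d) :
    integralHodgeClassesPullbackHom (liftHom (addHom X) (sndHom X X ≫ intMul X (-1))) d (integralHodgeClassesPullbackHom (sndHom X X) d c) =
      integralHodgeClassesPullbackHom (sndHom X X) d c := by
  rw [← integralHodgeClassesPullbackHom_comp, liftHom_addHom_sndNeg_comp_sndHom, integralHodgeClassesPullbackHom_comp, integralHodgeClassesPullbackHom_intMul,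
    pow_mul, neg_one_sq, one_pow, one_zsmul]

/-- **`ᵗΠ_c = Π_c`: THE PONTRYAGIN CORRESPONDENCE `Π_c = (s_X)_*(p₂^*c)` IS SYMMETRIC** for every `c ∈ Hdgᵈ(X, ℤ)` — `τ_*Π_c = (s ≫ τ)_*(p₂^*c) = (n ≫ s)_*(p₂^*c) =
s_*(n_*(n^*(p₂^*c))) = s_*(p₂^*c)` for the involution `n = (μ, −pr₂)` (`n_*n^* = 1`, g27-#3 `integralHodgeClassesPushforward_pullbackHom_of_isIso`; §0 and the previous
lemma). Fulton's transpose `α′ = τ_*α`; compare `(Δ_*(u))′ = Δ_*(u)` (g33-#3) and `H′ = −H` (g33-#5). [cite: Fulton1998, §16.1 (p0293 L12–L16: "α′ = τ_*(α)") and Prop. 16.1.1 (b)]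
[cite: Lange2023AbelianVarietiesComplex, §6.2.3 (p0308 L3–L7) and §6.3.4 (p0319 L28–L36)] -/
theorem integralHodgeClassesPushforward_swapHom_pontryaginCorrespondence (c : integralHodgeClasses X.toIsog.Φ d) :
    integralHodgeClassesPushforward d d (swapHom X X) eXX eXX hq hgXX hq hgXX
        (integralHodgeClassesPushforward d d (liftHom (fstHom X X) (fstHom X X + sndHom X X)) eXX eXX hq hgXX hq hgXX
          (integralHodgeClassesPullbackHom (sndHom X X) d c)) =
      integralHodgeClassesPushforward d d (liftHom (fstHom X X) (fstHom X X + sndHom X X)) eXX eXX hq hgXX hq hgXX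
        (integralHodgeClassesPullbackHom (sndHom X X) d c) := by
  haveI : IsIso (liftHom (addHom X) (sndHom X X ≫ intMul X (-1))) :=
    ⟨⟨liftHom (addHom X) (sndHom X X ≫ intMul X (-1)), liftHom_addHom_sndNeg_comp_self X, liftHom_addHom_sndNeg_comp_self X⟩⟩
  conv_lhs => rw [← integralHodgeClassesPullbackHom_liftHom_addHom_sndNeg_pullbackHom_sndHom X c,
    ← integralHodgeClassesPushforward_comp d d (liftHom (fstHom X X) (fstHom X X + sndHom X X)) eXX eXX hq hgXX hq hgXX d (swapHom X X) eXX hq hgXX,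
    ← liftHom_addHom_sndNeg_comp_liftHom_fst_add,
    integralHodgeClassesPushforward_comp d d (liftHom (addHom X) (sndHom X X ≫ intMul X (-1))) eXX eXX hq hgXX hq hgXX d
      (liftHom (fstHom X X) (fstHom X X + sndHom X X)) eXX hq hgXX,
    integralHodgeClassesPushforward_pullbackHom_of_isIso (liftHom (addHom X) (sndHom X X ≫ intMul X (-1))) eXX eXX hq hgXX]

/-! ## §2 `(Π_c)^*(y) = y ⋆ c` -/

/-- **`(Π_c)^*(y) = y ⋆ c` for all `y ∈ Hdgᵖ(X, ℤ)`, `c ∈ Hdgᵈ(X, ℤ)`** — `p_{1*}(Π_c · p₂^*y) = y ⋆ c`: the CONTRAVARIANT action `α^*(b) = p_{X*}(α · p_Y^*b)` of the Pontryagin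
correspondence is again the Pontryagin product with `c` (`(α′)_* = α^*`, Prop. 16.1.2 (b), g27-#6; `Π_c′ = Π_c`, §1; `(Π_c)_*(x) = x ⋆ c`, g33-#7 §2).
[cite: Fulton1998, §16.1 Def. 16.1.2 (p0295 L9–L17) and Prop. 16.1.2 (b) (p0295 L24–L26)] [cite: Lange2023AbelianVarietiesComplex, §6.2.3 (p0308 L3–L7)] -/
theorem integralHodgeClassesPushforward_fstHom_pontryaginCorrespondence_cup_pullbackHom_sndHom {p s t m : ℕ} (hs : d + p = s) (hps : p + d = s)
    (hm : m + 2 * s = 2 * gXX) (hm' : m + 2 * t = 2 * gX) (c : integralHodgeClasses X.toIsog.Φ d) (y : integralHodgeClasses X.toIsog.Φ p) :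
    integralHodgeClassesPushforward s t (fstHom X X) eXX eX hm hgXX hm' hgX
      (integralHodgeClassesCup (prodObj X X).toIsog.Φ hs
        (integralHodgeClassesPushforward d d (liftHom (fstHom X X) (fstHom X X + sndHom X X)) eXX eXX hq hgXX hq hgXX
          (integralHodgeClassesPullbackHom (sndHom X X) d c))
        (integralHodgeClassesPullbackHom (sndHom X X) p y)) =
      integralHodgeClassesPontryagin X eX eXX hgX hgXX hps hm hm' y c := by
  rw [← integralHodgeClassesPushforward_sndHom_swapHom_cup_pullbackHom_fstHom eX eXX eXX hgX hgXX hs hq hm hm'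
      (integralHodgeClassesPushforward d d (liftHom (fstHom X X) (fstHom X X + sndHom X X)) eXX eXX hq hgXX hq hgXX
        (integralHodgeClassesPullbackHom (sndHom X X) d c)) y,
    integralHodgeClassesPushforward_swapHom_pontryaginCorrespondence X eXX hgXX hq c,
    integralHodgeClassesPushforward_sndHom_pontryaginCorrespondence_cup_pullbackHom_fstHom X eX eXX hgX hgXX hq hs hps hm hm' c y]

end Transpose

/-! ## §3 `Π_c ∘ Π_{c′} = Π_{c′ ⋆ c}` -/

section Composition

variable (X : ComplexTorusCat) {gX gXX gT gQ : ℕ} (eX : Fin (2 * gX) ≃ X.toIsog.ι) (eXX : Fin (2 * gXX) ≃ (prodObj X X).toIsog.ι)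
  (eT : Fin (2 * gT) ≃ (prodObj X (prodObj X X)).toIsog.ι) (eQ : Fin (2 * gQ) ≃ (prodObj X (prodObj (prodObj X X) X)).toIsog.ι)
  (hX0 : 2 * gX + 2 * 0 = 2 * gX) (hgX : gX + gX = 2 * gX) (hcX : 2 * gX + 2 * gX = 2 * gXX) (hgXX : gXX + gXX = 2 * gXX) (hgT : gT + gT = 2 * gT)
  (hgQ : gQ + gQ = 2 * gQ) (hN : 2 * gX + 2 * gXX = 2 * gT) (hgg₀ : gX + gXX = gT) (hXX0 : 2 * gXX + 2 * 0 = 2 * gXX) (hlr₀ : 2 * gXX + 2 * gX = 2 * gT)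
  (hXXg : gX + gX = gXX) (hTX : gXX + gX = gT) (hQT : gT + gX = gQ)
  {p d K e Kp L' l₃ l₁ L : ℕ} (hq' : L' + 2 * p = 2 * gXX) (hKp : gX + p = Kp) (hLp : L' + 2 * Kp = 2 * gT) (hq : L + 2 * d = 2 * gXX)
  (hK : p + d = K) (hKe : gX + e = K) (h3 : l₃ + 2 * K = 2 * gT) (h3' : l₃ + 2 * e = 2 * gXX) (hl₁ : l₁ + 2 * K = 2 * gXX) (hl₁' : l₁ + 2 * e = 2 * gX)

include eQ hX0 hcX hgQ hN hgg₀ hXX0 hlr₀ hXXg hTX hQT hKp hLp hKe in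
/-- **`Π_c ∘ Π_{c′} = Π_{c′ ⋆ c}` for `c′ ∈ Hdgᵖ(X, ℤ)`, `c ∈ Hdgᵈ(X, ℤ)`** — `p₁₃_*(p₁₂^*Π_{c′} · p₂₃^*Π_c) = (s_X)_*(p₂^*(c′ ⋆ c))` on `X × (X × X)`, with `c′ ⋆ c = μ_*(c′ ⊠ c)
∈ Hdg^{p+d−g}(X, ℤ)` the Pontryagin product (g31-#4): THE MAP `c ↦ Π_c` TURNS THE PONTRYAGIN PRODUCT OF `X` INTO THE COMPOSITION OF CORRESPONDENCES (and induces `x ↦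
(x ⋆ c′) ⋆ c = x ⋆ (c′ ⋆ c)` on `Hdg•(X, ℤ)`). Proof: `Π_c ∘ Π_{c′} = Π_{c′} ⋆_X (X × c)` (g33-#7 §3), `Π_{c′} = [Δ] ⋆_X (X × c′)` (g33-#7 §1), associativity of `⋆_X`
(g31-#10 `integralHodgeClassesRelPontryagin_assoc`), `(X × c′) ⋆_X (X × c) = X × (c′ ⋆ c)` (g33-#7 §4), and g33-#7 §1 again — "`(Ch(X)_ℚ, +, ⋆)` is a commutative
ring", realised in "`A(X × X)` … an associative ring with unit `[Δ_X]`". [cite: Lange2023AbelianVarietiesComplex, §6.2.3 (p0308 L3–L12) and §6.3.4 (p0319 L36–L41)]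
[cite: Fulton1998, §16.1 Def. 16.1.1 (p0293 L3–L8) and Cor. 16.1.1 (p0295 L7)] [cite: Moonen2011ChowMotiveAbelianSchemes, §5 (arXiv p0014 L78)] -/
theorem integralHodgeClassesCorrComp_pontryaginCorrespondence_pontryaginCorrespondence (c' : integralHodgeClasses X.toIsog.Φ p)
    (c : integralHodgeClasses X.toIsog.Φ d) :
    integralHodgeClassesPushforward K e (liftHom (fstHom X (prodObj X X)) (sndHom X (prodObj X X) ≫ sndHom X X)) eT eXX h3 hgT h3' hgXX
      (integralHodgeClassesCup (prodObj X (prodObj X X)).toIsog.Φ hK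
        (integralHodgeClassesPullbackHom (liftHom (fstHom X (prodObj X X)) (sndHom X (prodObj X X) ≫ fstHom X X)) p
          (integralHodgeClassesPushforward p p (liftHom (fstHom X X) (fstHom X X + sndHom X X)) eXX eXX hq' hgXX hq' hgXX
            (integralHodgeClassesPullbackHom (sndHom X X) p c')))
        (integralHodgeClassesPullbackHom (sndHom X (prodObj X X)) d
          (integralHodgeClassesPushforward d d (liftHom (fstHom X X) (fstHom X X + sndHom X X)) eXX eXX hq hgXX hq hgXX
            (integralHodgeClassesPullbackHom (sndHom X X) d c)))) =
      integralHodgeClassesPushforward e e (liftHom (fstHom X X) (fstHom X X + sndHom X X)) eXX eXX h3' hgXX h3' hgXX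
        (integralHodgeClassesPullbackHom (sndHom X X) e (integralHodgeClassesPontryagin X eX eXX hgX hgXX hK hl₁ hl₁' c' c)) := by
  rw [integralHodgeClassesCorrComp_pontryaginCorrespondence_right eX eXX eXX eT hgXX hgXX hgT hN hK h3 h3' hq
      (integralHodgeClassesPushforward p p (liftHom (fstHom X X) (fstHom X X + sndHom X X)) eXX eXX hq' hgXX hq' hgXX
        (integralHodgeClassesPullbackHom (sndHom X X) p c')) c,
    ← integralHodgeClassesRelPontryagin_diagonalClass_pullbackHom_sndHom X eX eXX eT hX0 hgX hcX hgXX hgT hgg₀ hXX0 hlr₀ hKp hLp hq' c',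
    integralHodgeClassesRelPontryagin_assoc hXXg hTX hQT eX eXX eXX eT eQ hgXX hgT hgQ hKp hLp hq' hK h3 h3' hK h3 h3' hKe h3 h3',
    integralHodgeClassesRelPontryagin_pullbackHom_sndHom_pullbackHom_sndHom eX eX eXX eXX eT hgX hgXX hgXX hgT hN hcX hK h3 h3' hl₁ hl₁' c' c,
    integralHodgeClassesRelPontryagin_diagonalClass_pullbackHom_sndHom X eX eXX eT hX0 hgX hcX hgXX hgT hgg₀ hXX0 hlr₀ hKe h3 h3']

include eX eQ hX0 hgX hcX hgQ hN hgg₀ hXX0 hlr₀ hXXg hTX hQT hKp hLp hKe hl₁ hl₁' in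
/-- **`Π_c ∘ Π_{c′} = Π_{c′} ∘ Π_c`**: Pontryagin correspondences commute with one another (both composites are `Π_{c′ ⋆ c} = Π_{c ⋆ c′}`; the Pontryagin product is
commutative, g31-#4 `integralHodgeClassesPontryagin_comm`). [cite: Lange2023AbelianVarietiesComplex, §6.2.3 (p0308 L8–L12: "commutative ring")] [cite: Fulton1998, §16.1 Cor. 16.1.1 (p0295 L7)] -/
theorem integralHodgeClassesCorrComp_pontryaginCorrespondence_pontryaginCorrespondence_comm {Kd L'' : ℕ} (hq'' : L'' + 2 * d = 2 * gXX) (hKd : gX + d = Kd)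
    (hLd : L'' + 2 * Kd = 2 * gT) (hK' : d + p = K) (c' : integralHodgeClasses X.toIsog.Φ p) (c : integralHodgeClasses X.toIsog.Φ d) :
    integralHodgeClassesPushforward K e (liftHom (fstHom X (prodObj X X)) (sndHom X (prodObj X X) ≫ sndHom X X)) eT eXX h3 hgT h3' hgXX
      (integralHodgeClassesCup (prodObj X (prodObj X X)).toIsog.Φ hK
        (integralHodgeClassesPullbackHom (liftHom (fstHom X (prodObj X X)) (sndHom X (prodObj X X) ≫ fstHom X X)) p
          (integralHodgeClassesPushforward p p (liftHom (fstHom X X) (fstHom X X + sndHom X X)) eXX eXX hq' hgXX hq' hgXX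
            (integralHodgeClassesPullbackHom (sndHom X X) p c')))
        (integralHodgeClassesPullbackHom (sndHom X (prodObj X X)) d
          (integralHodgeClassesPushforward d d (liftHom (fstHom X X) (fstHom X X + sndHom X X)) eXX eXX hq hgXX hq hgXX
            (integralHodgeClassesPullbackHom (sndHom X X) d c)))) =
      integralHodgeClassesPushforward K e (liftHom (fstHom X (prodObj X X)) (sndHom X (prodObj X X) ≫ sndHom X X)) eT eXX h3 hgT h3' hgXX
        (integralHodgeClassesCup (prodObj X (prodObj X X)).toIsog.Φ hK'
          (integralHodgeClassesPullbackHom (liftHom (fstHom X (prodObj X X)) (sndHom X (prodObj X X) ≫ fstHom X X)) d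
            (integralHodgeClassesPushforward d d (liftHom (fstHom X X) (fstHom X X + sndHom X X)) eXX eXX hq'' hgXX hq'' hgXX
              (integralHodgeClassesPullbackHom (sndHom X X) d c)))
          (integralHodgeClassesPullbackHom (sndHom X (prodObj X X)) p
            (integralHodgeClassesPushforward p p (liftHom (fstHom X X) (fstHom X X + sndHom X X)) eXX eXX hq' hgXX hq' hgXX
              (integralHodgeClassesPullbackHom (sndHom X X) p c')))) := by
  rw [integralHodgeClassesCorrComp_pontryaginCorrespondence_pontryaginCorrespondence X eX eXX eT eQ hX0 hgX hcX hgXX hgT hgQ hN hgg₀ hXX0 hlr₀ hXXg hTX hQT hq' hKp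
      hLp hq hK hKe h3 h3' hl₁ hl₁' c' c,
    integralHodgeClassesCorrComp_pontryaginCorrespondence_pontryaginCorrespondence X eX eXX eT eQ hX0 hgX hcX hgXX hgT hgQ hN hgg₀ hXX0 hlr₀ hXXg hTX hQT hq'' hKd
      hLd hq' hK' hKe h3 h3' hl₁ hl₁' c c',
    integralHodgeClassesPontryagin_comm X eX eXX hgX hgXX hK hl₁ hl₁' hK']

end Composition

/-! ## §4 `Γ_f ∘ Π_c = (s_f)_*(p₂^*(f_*c)) = Π_{f_*c} ∘ Γ_f` -/

section Graph

variable {X Y : ComplexTorusCat} (f : X ⟶ Y) {gX gY gXX gXY gYY gT₁ gT₂ : ℕ} (eX : Fin (2 * gX) ≃ X.toIsog.ι) (eY : Fin (2 * gY) ≃ Y.toIsog.ι)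
  (eXX : Fin (2 * gXX) ≃ (prodObj X X).toIsog.ι) (eXY : Fin (2 * gXY) ≃ (prodObj X Y).toIsog.ι) (eYY : Fin (2 * gYY) ≃ (prodObj Y Y).toIsog.ι)
  (eT₁ : Fin (2 * gT₁) ≃ (prodObj X (prodObj X Y)).toIsog.ι) (eT₂ : Fin (2 * gT₂) ≃ (prodObj X (prodObj Y Y)).toIsog.ι)
  (hX0 : 2 * gX + 2 * 0 = 2 * gX) (hgX : gX + gX = 2 * gX) (hgY : gY + gY = 2 * gY) (hcX : 2 * gX + 2 * gX = 2 * gXX) (hgXX : gXX + gXX = 2 * gXX)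
  (hXY : 2 * gX + 2 * gY = 2 * gXY) (hgXY : gXY + gXY = 2 * gXY) (hgYY : gYY + gYY = 2 * gYY) (hgT₁ : gT₁ + gT₁ = 2 * gT₁) (hgT₂ : gT₂ + gT₂ = 2 * gT₂)
  (hgg₁ : gXX + gY = gT₁) (hXX0 : 2 * gXX + 2 * 0 = 2 * gXX) (hlr₁ : 2 * gXX + 2 * gY = 2 * gT₁)
  (hgg₂ : gY + gXY = gT₂) (hXY0 : 2 * gXY + 2 * 0 = 2 * gXY) (hlr₂ : 2 * gXY + 2 * gY = 2 * gT₂) (hN₂ : 2 * gX + 2 * gYY = 2 * gT₂)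
  {d d' lX L LY c₁ K₂ : ℕ} (hlX : lX + 2 * d = 2 * gX) (hlX' : lX + 2 * d' = 2 * gY) (hq : L + 2 * d = 2 * gXX) (hq' : L + 2 * d' = 2 * gXY)
  (hac : d + gY = c₁) (hr : L + 2 * c₁ = 2 * gT₁) (hqY : LY + 2 * d' = 2 * gYY) (hK₂ : gY + d' = K₂) (h3 : L + 2 * K₂ = 2 * gT₂)

include hcX hgg₁ hXX0 hlr₁ in
/-- **`Γ_f ∘ Π_c = (s_f)_*(p₂^*(f_*c))` for every homomorphism `f : X → Y` and `c ∈ Hdgᵈ(X, ℤ)`** — `p₁₃_*(p₁₂^*Π_c · p₂₃^*[Γ_f])` on `X × (X × Y)` is the push-forward of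
`p₂^*(f_*c)` along the shear `s_f = (pr₁, f pr₁ + pr₂)` of `X × Y`: `Γ_f ∘ α = (1_X × f)_*α` (Prop. 16.1.1 (c)(i), g27-#5), `s_X ≫ (1 × f) = (1 × f) ≫ s_f` (§0) and the
base change `(1_X × f)_*(p₂^*c) = p₂^*(f_*c)` (g27-#8). [cite: Fulton1998, §16.1 Prop. 16.1.1 (c)(i) with proof (p0293 L24; p0294 L21–L26) and §1.7 Prop. 1.7 (p0030)]
[cite: Lange2023AbelianVarietiesComplex, §6.3.4 (p0319 L28–L36)] -/
theorem integralHodgeClassesCorrComp_pontryaginCorrespondence_graphClass (c : integralHodgeClasses X.toIsog.Φ d) :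
    integralHodgeClassesPushforward c₁ d' (liftHom (fstHom X (prodObj X Y)) (sndHom X (prodObj X Y) ≫ sndHom X Y)) eT₁ eXY hr hgT₁ hq' hgXY
      (integralHodgeClassesCup (prodObj X (prodObj X Y)).toIsog.Φ hac
        (integralHodgeClassesPullbackHom (liftHom (fstHom X (prodObj X Y)) (sndHom X (prodObj X Y) ≫ fstHom X Y)) d
          (integralHodgeClassesPushforward d d (liftHom (fstHom X X) (fstHom X X + sndHom X X)) eXX eXX hq hgXX hq hgXX
            (integralHodgeClassesPullbackHom (sndHom X X) d c)))
        (integralHodgeClassesPullbackHom (sndHom X (prodObj X Y)) gY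
          (integralHodgeClassesPushforward 0 gY (graphHom f) eX eXY hX0 hgX hXY hgXY (unitIntegralHodgeClass X)))) =
      integralHodgeClassesPushforward d' d' (liftHom (fstHom X Y) (fstHom X Y ≫ f + sndHom X Y)) eXY eXY hq' hgXY hq' hgXY
        (integralHodgeClassesPullbackHom (sndHom X Y) d' (integralHodgeClassesPushforward d d' f eX eY hlX hgX hlX' hgY c)) := by
  obtain rfl : L = 2 * gX + lX := by omega
  rw [integralHodgeClassesCorrComp_graphClass_right hgg₁ f eX eY eXX eXY eXY eT₁ hX0 hgX hXY hgXY hXX0 hgXX hlr₁ hgT₁ hgXY hac hq hr hq'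
      (integralHodgeClassesPushforward d d (liftHom (fstHom X X) (fstHom X X + sndHom X X)) eXX eXX hq hgXX hq hgXX
        (integralHodgeClassesPullbackHom (sndHom X X) d c)),
    ← integralHodgeClassesPushforward_comp d d (liftHom (fstHom X X) (fstHom X X + sndHom X X)) eXX eXX hq hgXX hq hgXX d' (prodMap (𝟙 X) f) eXY hq' hgXY,
    liftHom_fst_add_comp_prodMap_id,
    integralHodgeClassesPushforward_comp d d' (prodMap (𝟙 X) f) eXX eXY hq hgXX hq' hgXY d' (liftHom (fstHom X Y) (fstHom X Y ≫ f + sndHom X Y)) eXY hq' hgXY,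
    integralHodgeClassesPushforward_id_prodMap_pullbackHom_sndHom' f X eX eY hlX hgX hlX' hgY eX eXX eXY hcX hXY hq hgXX hq' hgXY c]

include eYY hgg₂ hXY0 hlr₂ hN₂ in
/-- **`Π_{f_*c} ∘ Γ_f = (s_f)_*(p₂^*(f_*c))`** likewise — `p₁₃_*(p₁₂^*[Γ_f] · p₂₃^*Π_{f_*c})` on `X × (Y × Y)`: `Π_{f_*c} ∘ [Γ_f] = [Γ_f] ⋆_X (X × f_*c)` (g33-#7 §3) and the shear
formula `[Γ_f] ⋆_X β = (s_f)_*β` (g31-#5). [cite: Lange2023AbelianVarietiesComplex, §6.3.4 Lemma 6.3.13 (proof, p0320 L13–L17)] [cite: Fulton1998, §16.1 Def. 16.1.1 (p0293 L3–L8)] -/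
theorem integralHodgeClassesCorrComp_graphClass_pontryaginCorrespondence (c : integralHodgeClasses X.toIsog.Φ d) :
    integralHodgeClassesPushforward K₂ d' (liftHom (fstHom X (prodObj Y Y)) (sndHom X (prodObj Y Y) ≫ sndHom Y Y)) eT₂ eXY h3 hgT₂ hq' hgXY
      (integralHodgeClassesCup (prodObj X (prodObj Y Y)).toIsog.Φ hK₂
        (integralHodgeClassesPullbackHom (liftHom (fstHom X (prodObj Y Y)) (sndHom X (prodObj Y Y) ≫ fstHom Y Y)) gY
          (integralHodgeClassesPushforward 0 gY (graphHom f) eX eXY hX0 hgX hXY hgXY (unitIntegralHodgeClass X)))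
        (integralHodgeClassesPullbackHom (sndHom X (prodObj Y Y)) d'
          (integralHodgeClassesPushforward d' d' (liftHom (fstHom Y Y) (fstHom Y Y + sndHom Y Y)) eYY eYY hqY hgYY hqY hgYY
            (integralHodgeClassesPullbackHom (sndHom Y Y) d' (integralHodgeClassesPushforward d d' f eX eY hlX hgX hlX' hgY c))))) =
      integralHodgeClassesPushforward d' d' (liftHom (fstHom X Y) (fstHom X Y ≫ f + sndHom X Y)) eXY eXY hq' hgXY hq' hgXY
        (integralHodgeClassesPullbackHom (sndHom X Y) d' (integralHodgeClassesPushforward d d' f eX eY hlX hgX hlX' hgY c)) := by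
  rw [integralHodgeClassesCorrComp_pontryaginCorrespondence_right eX eYY eXY eT₂ hgYY hgXY hgT₂ hN₂ hK₂ h3 hq' hqY
      (integralHodgeClassesPushforward 0 gY (graphHom f) eX eXY hX0 hgX hXY hgXY (unitIntegralHodgeClass X))
      (integralHodgeClassesPushforward d d' f eX eY hlX hgX hlX' hgY c),
    integralHodgeClassesRelPontryagin_graphClass_left hgg₂ f eX eY eXY eT₂ hX0 hgX hXY hgXY hXY0 hlr₂ hgT₂ hK₂ h3 hq']

include hcX hgg₁ hXX0 hlr₁ hgg₂ hXY0 hlr₂ hN₂ in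
/-- **`Γ_f ∘ Π_c = Π_{f_*c} ∘ Γ_f` FOR EVERY HOMOMORPHISM `f : X → Y` OF COMPLEX TORI AND EVERY `c ∈ Hdgᵈ(X, ℤ)`** (composites on `X × (X × Y)` and `X × (Y × Y)`): the
graph of a homomorphism intertwines the Pontryagin correspondences of `c` and of `f_*c` — the correspondence form of `f_*(x ⋆ c) = f_*x ⋆ f_*c` ("for a homomorphism
`f`, `f_*` is a ring homomorphism for the Pontryagin product", g31-#4 `integralHodgeClassesPushforward_pontryagin`), both sides being `(s_f)_*(p₂^*(f_*c))` (the two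
previous theorems). [cite: Lange2023AbelianVarietiesComplex, §6.2.3 (p0308 L3–L12)] [cite: Fulton1998, §16.1 Prop. 16.1.1 (c) (p0293 L24–L26)] -/
theorem integralHodgeClassesCorrComp_pontryaginCorrespondence_graphClass_eq_corrComp_graphClass_pontryaginCorrespondence (c : integralHodgeClasses X.toIsog.Φ d) :
    integralHodgeClassesPushforward c₁ d' (liftHom (fstHom X (prodObj X Y)) (sndHom X (prodObj X Y) ≫ sndHom X Y)) eT₁ eXY hr hgT₁ hq' hgXY
      (integralHodgeClassesCup (prodObj X (prodObj X Y)).toIsog.Φ hac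
        (integralHodgeClassesPullbackHom (liftHom (fstHom X (prodObj X Y)) (sndHom X (prodObj X Y) ≫ fstHom X Y)) d
          (integralHodgeClassesPushforward d d (liftHom (fstHom X X) (fstHom X X + sndHom X X)) eXX eXX hq hgXX hq hgXX
            (integralHodgeClassesPullbackHom (sndHom X X) d c)))
        (integralHodgeClassesPullbackHom (sndHom X (prodObj X Y)) gY
          (integralHodgeClassesPushforward 0 gY (graphHom f) eX eXY hX0 hgX hXY hgXY (unitIntegralHodgeClass X)))) =
      integralHodgeClassesPushforward K₂ d' (liftHom (fstHom X (prodObj Y Y)) (sndHom X (prodObj Y Y) ≫ sndHom Y Y)) eT₂ eXY h3 hgT₂ hq' hgXY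
        (integralHodgeClassesCup (prodObj X (prodObj Y Y)).toIsog.Φ hK₂
          (integralHodgeClassesPullbackHom (liftHom (fstHom X (prodObj Y Y)) (sndHom X (prodObj Y Y) ≫ fstHom Y Y)) gY
            (integralHodgeClassesPushforward 0 gY (graphHom f) eX eXY hX0 hgX hXY hgXY (unitIntegralHodgeClass X)))
          (integralHodgeClassesPullbackHom (sndHom X (prodObj Y Y)) d'
            (integralHodgeClassesPushforward d' d' (liftHom (fstHom Y Y) (fstHom Y Y + sndHom Y Y)) eYY eYY hqY hgYY hqY hgYY
              (integralHodgeClassesPullbackHom (sndHom Y Y) d' (integralHodgeClassesPushforward d d' f eX eY hlX hgX hlX' hgY c))))) := by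
  rw [integralHodgeClassesCorrComp_pontryaginCorrespondence_graphClass f eX eY eXX eXY eT₁ hX0 hgX hgY hcX hgXX hXY hgXY hgT₁ hgg₁ hXX0 hlr₁ hlX hlX' hq hq' hac hr c,
    integralHodgeClassesCorrComp_graphClass_pontryaginCorrespondence f eX eY eXY eYY eT₂ hX0 hgX hgY hXY hgXY hgYY hgT₂ hgg₂ hXY0 hlr₂ hN₂ hlX hlX' hq' hqY hK₂ h3 c]

end Graph

/-! ## §5 `Π_{[pt]} = [Δ]`, `Π_1 = 1`, additivity -/

section Special

variable (X : ComplexTorusCat) {gX gXX : ℕ} (eX : Fin (2 * gX) ≃ X.toIsog.ι) (eXX : Fin (2 * gXX) ≃ (prodObj X X).toIsog.ι) (hX0 : 2 * gX + 2 * 0 = 2 * gX)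
  (hgX : gX + gX = 2 * gX) (hcX : 2 * gX + 2 * gX = 2 * gXX) (hgXX : gXX + gXX = 2 * gXX) (hXXg : gX + gX = gXX) {d L : ℕ} (hq : L + 2 * d = 2 * gXX)

include hXXg in
/-- **`Π_{[pt_X]} = [Δ_X]`**: the Pontryagin correspondence of the point class is the diagonal, i.e. the identity correspondence (`x ⋆ [pt] = x`: "`(Ch(X)_ℚ, +, ⋆)` is a
commutative ring with unit `1 = [0]`, the class of the origin") — `p₂^*[pt] = [X × (0)] = (ι₁)_*(1_X)` (g27-#4) and `ι₁ ≫ s = Δ` (§0).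
[cite: Lange2023AbelianVarietiesComplex, §6.2.3 (p0308 L8–L12) and §6.3.4 (p0319 L38–L40: "unit element `X × (0)`")] [cite: Fulton1998, §16.1 Cor. 16.1.1 (p0295 L7)] -/
theorem pontryaginCorrespondence_pointIntegralHodgeClass {L₀ : ℕ} (hq₀ : L₀ + 2 * gX = 2 * gXX) :
    integralHodgeClassesPushforward gX gX (liftHom (fstHom X X) (fstHom X X + sndHom X X)) eXX eXX hq₀ hgXX hq₀ hgXX
        (integralHodgeClassesPullbackHom (sndHom X X) gX (pointIntegralHodgeClass X eX)) =
      integralHodgeClassesPushforward 0 gX (diagHom X) eX eXX hX0 hgX hcX hgXX (unitIntegralHodgeClass X) := by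
  obtain rfl : L₀ = 2 * gX := by omega
  rw [← integralHodgeClassesCross_unitIntegralHodgeClass_left, ← integralHodgeClassesPushforward_inlHom_unitIntegralHodgeClass X X hXXg eX eX eXX hX0 hgX hcX hgXX,
    ← integralHodgeClassesPushforward_comp 0 gX (inlHom X X) eX eXX hX0 hgX hcX hgXX gX (liftHom (fstHom X X) (fstHom X X + sndHom X X)) eXX hq₀ hgXX,
    inlHom_comp_liftHom_fst_add]

/-- **`Π_{1_X} = 1_{X×X}`**: the Pontryagin correspondence of the unit class is the unit class (`p₂^*1 = 1`, and `s_*1 = 1` for the isomorphism `s`). It induces `x ↦ x ⋆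
1_X = p_{2*}(p₁^*x)`, i.e. `deg(x) · 1_X` on top classes and `0` below (Lange's `p_{2*}(x ⊗ y) = d(x)y`, g27-#2). [cite: Lange2023AbelianVarietiesComplex, §6.2.4 (6.10) (p0310 L33–L35) and §6.3.4 (p0319 L28–L36)]
[cite: Fulton1998, Example 1.7.4 (p0031 L17–L21)] -/
theorem pontryaginCorrespondence_unitIntegralHodgeClass {L₀ : ℕ} (hq₀ : L₀ + 2 * 0 = 2 * gXX) :
    integralHodgeClassesPushforward 0 0 (liftHom (fstHom X X) (fstHom X X + sndHom X X)) eXX eXX hq₀ hgXX hq₀ hgXX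
        (integralHodgeClassesPullbackHom (sndHom X X) 0 (unitIntegralHodgeClass X)) = unitIntegralHodgeClass (prodObj X X) := by
  haveI : IsIso (liftHom (fstHom X X) (fstHom X X + sndHom X X)) :=
    ⟨⟨liftHom (fstHom X X) (sndHom X X - fstHom X X), liftHom_fst_add_comp_liftHom_fst_sub X, liftHom_fst_sub_comp_liftHom_fst_add X⟩⟩
  rw [integralHodgeClassesPullbackHom_unitIntegralHodgeClass, integralHodgeClassesPushforward_of_isIso, integralHodgeClassesPullbackHom_unitIntegralHodgeClass]

/-- **`Π_{c₁ + c₂} = Π_{c₁} + Π_{c₂}`**: `c ↦ Π_c` is additive (`p₂^*` and `s_*` are). With §3 it is a homomorphism from `(Hdg•(X, ℤ), +, ⋆)` to the correspondences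
under `(+, ∘)` (order of composition reversed, immaterial by §3's commutativity). [cite: Lange2023AbelianVarietiesComplex, §6.2.3 (p0308 L8–L12)] [cite: Fulton1998, §16.1 Cor. 16.1.1 (p0295 L7)] -/
theorem pontryaginCorrespondence_add (c₁ c₂ : integralHodgeClasses X.toIsog.Φ d) :
    integralHodgeClassesPushforward d d (liftHom (fstHom X X) (fstHom X X + sndHom X X)) eXX eXX hq hgXX hq hgXX
        (integralHodgeClassesPullbackHom (sndHom X X) d (c₁ + c₂)) =
      integralHodgeClassesPushforward d d (liftHom (fstHom X X) (fstHom X X + sndHom X X)) eXX eXX hq hgXX hq hgXX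
          (integralHodgeClassesPullbackHom (sndHom X X) d c₁) +
        integralHodgeClassesPushforward d d (liftHom (fstHom X X) (fstHom X X + sndHom X X)) eXX eXX hq hgXX hq hgXX
          (integralHodgeClassesPullbackHom (sndHom X X) d c₂) := by
  rw [map_add, map_add]

/-- **`Π_{n • c} = n • Π_c`** for `n ∈ ℤ`. [cite: Lange2023AbelianVarietiesComplex, §6.2.3 (p0308 L8–L12)] -/
theorem pontryaginCorrespondence_zsmul (n : ℤ) (c : integralHodgeClasses X.toIsog.Φ d) :
    integralHodgeClassesPushforward d d (liftHom (fstHom X X) (fstHom X X + sndHom X X)) eXX eXX hq hgXX hq hgXX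
        (integralHodgeClassesPullbackHom (sndHom X X) d (n • c)) =
      n • integralHodgeClassesPushforward d d (liftHom (fstHom X X) (fstHom X X + sndHom X X)) eXX eXX hq hgXX hq hgXX
        (integralHodgeClassesPullbackHom (sndHom X X) d c) := by
  rw [map_zsmul, map_zsmul]

end Special

/-! ## §6 The Künneth weight of `Π_c`: `[H, Π_c] = (2d − 2g) • Π_c` -/

section Weight

variable (X : ComplexTorusCat) {gX gXX gT : ℕ} (eX : Fin (2 * gX) ≃ X.toIsog.ι) (eXX eXX' eXX'' : Fin (2 * gXX) ≃ (prodObj X X).toIsog.ι)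
  (hX0 : 2 * gX + 2 * 0 = 2 * gX) (hgX : gX + gX = 2 * gX) (hcX : 2 * gX + 2 * gX = 2 * gXX) (hgXX : gXX + gXX = 2 * gXX)
  (eT : Fin (2 * gT) ≃ (prodObj X (prodObj X X)).toIsog.ι) (hgT : gT + gT = 2 * gT) (hgg : gXX + gX = gT) (hXX0 : 2 * gXX + 2 * 0 = 2 * gXX)
  (hlr : 2 * gXX + 2 * gX = 2 * gT)

include hgg hXX0 hlr in
/-- **`H ∘ Π_c − Π_c ∘ H = (2d − 2g) • Π_c` for `c ∈ Hdgᵈ(X, ℤ)`** (composites on `X × (X × X)`; `H = Σ_s (s − g) π_s` the grading correspondence of g33-#5): the Pontryagin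
correspondence `Π_c ∈ Hdgᵈ(X × X, ℤ)` has Künneth weight `2d − 2g` — it lowers cohomological degree by `2g − 2d` (`x ⋆ c ∈ Hdg^{p+d−g}` for `x ∈ Hdgᵖ`). The instance `α =
Π_c`, `a = d`, `Z = X` of the weight identity `H_Z ∘ α − α ∘ H_X = (2a − g_X − g_Z) • α` (g33-#5 `integralHodgeClassesCorrComp_kunnethGrading_sub`). For `d = g − 1` (e.g.
`c = θ^{g−1}/(g−1)!` for a principal polarization `θ`) it reads **`[H, Λ] = −2Λ`**, the third relation of Künnemann's Lefschetz 𝔰𝔩₂-triple `(L_θ = Δ_*(θ), H, Λ = Π_c)`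
next to `[H, L] = 2L` (g33-#5 `integralHodgeClassesCorrComp_kunnethGrading_pushforward_diagHom_sub`). [cite: Moonen2011ChowMotiveAbelianSchemes, §5 (arXiv p0014 L47–L78; p0015 L2–L12)]
[cite: Huybrechts2005, §1.2 Def. 1.2.25 and Prop. 1.2.26 (p0047)] -/
theorem integralHodgeClassesCorrComp_kunnethGrading_pontryaginCorrespondence_sub {d K L l₃ : ℕ} (hq : L + 2 * d = 2 * gXX) (hK : gX + d = K) (hK' : d + gX = K)
    (h3 : l₃ + 2 * K = 2 * gT) (h3' : l₃ + 2 * d = 2 * gXX) (c : integralHodgeClasses X.toIsog.Φ d) :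
    integralHodgeClassesPushforward K d (liftHom (fstHom X (prodObj X X)) (sndHom X (prodObj X X) ≫ sndHom X X)) eT eXX' h3 hgT h3' hgXX
      (integralHodgeClassesCup (prodObj X (prodObj X X)).toIsog.Φ hK'
        (integralHodgeClassesPullbackHom (liftHom (fstHom X (prodObj X X)) (sndHom X (prodObj X X) ≫ fstHom X X)) d
          (integralHodgeClassesPushforward d d (liftHom (fstHom X X) (fstHom X X + sndHom X X)) eXX'' eXX'' hq hgXX hq hgXX
            (integralHodgeClassesPullbackHom (sndHom X X) d c)))
        (integralHodgeClassesPullbackHom (sndHom X (prodObj X X)) gX (kunnethGrading X eX eXX hX0 hgX hcX hgXX))) -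
      integralHodgeClassesPushforward K d (liftHom (fstHom X (prodObj X X)) (sndHom X (prodObj X X) ≫ sndHom X X)) eT eXX' h3 hgT h3' hgXX
        (integralHodgeClassesCup (prodObj X (prodObj X X)).toIsog.Φ hK
          (integralHodgeClassesPullbackHom (liftHom (fstHom X (prodObj X X)) (sndHom X (prodObj X X) ≫ fstHom X X)) gX (kunnethGrading X eX eXX hX0 hgX hcX hgXX))
          (integralHodgeClassesPullbackHom (sndHom X (prodObj X X)) d
            (integralHodgeClassesPushforward d d (liftHom (fstHom X X) (fstHom X X + sndHom X X)) eXX'' eXX'' hq hgXX hq hgXX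
              (integralHodgeClassesPullbackHom (sndHom X X) d c)))) =
      ((2 * d : ℤ) - 2 * gX) • integralHodgeClassesPushforward d d (liftHom (fstHom X X) (fstHom X X + sndHom X X)) eXX'' eXX'' hq hgXX hq hgXX
        (integralHodgeClassesPullbackHom (sndHom X X) d c) := by
  rw [integralHodgeClassesCorrComp_kunnethGrading_sub eX eXX hX0 hgX hcX hgXX eX eXX hX0 hgX hcX hgXX eT eT eXX' hK h3 hgT h3' hgXX hK' h3 hgT h3' hgg hXX0 hlr]
  congr 1
  omega

end Weight

end ComplexTorusCat

end Literature.AlgebraicGeometry.HodgeTheory
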